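import Literature.NumberTheory.EllipticCurves.IwasawaAlgebraInvolutionEvenLambdaProofs
import Literature.NumberTheory.EllipticCurves.Kato2004.IwasawaInvolutionTwistProofs
import HarnessLib

/-!
# Crux `SprungLowerDivisibilityAtThree` (K1, item stmt-BirchSwinnertonDyer-19875), line `chromatic-common-zeros`,
# stub `K_spor` (child stmt-BirchSwinnertonDyer-22569): the `ι`-PARITY DOOR — an `ι`-symmetric `λ`-weighted defect
# sum over height-one primes `∌ T` is EVEN (`p` odd), so a total budget `≤ 1` kills every defect off `(T)`

Cell `bsd-ssimc` (host), width seat `cruxlead-stmt-BirchSwinnertonDyer-19875-w2` (gen 10) under the 19875 LEAD;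
`--supports stmt-BirchSwinnertonDyer-22569 --as helper`; THEOREMS ONLY; route-independent imports (Literature only);
closes NO item. This is idea card `Ideas/stub-katofinelowersporadic-k2-g4.md` §B («parity / budget-one door»,
helpers B0–B3; STUB-PLAN v8 §D (2) keying-immune helper queue) in the tree's vocabulary:

* B0 = `Literature.….IwasawaAlgebra.even_lambdaInvariant_quotient_of_comap_invol_eq` (landed with this file's
  Literature companion `IwasawaAlgebraInvolutionEvenLambdaProofs`): at an `ι`-FIXED prime `𝔭 ∌ T` of `Λ`
  (`p ≠ 2`) the degree `d(𝔭) := λ(Λ/𝔭)` is even; and `d(ι𝔭) = d(𝔭)` always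
  (`lambdaInvariant_quotient_comap_invol_asIdeal_eq`).
* B1 `even_sum_of_invol_pairing` / `even_sum_mul_of_invol_pairing` — pure finite sums: an involution `g` of a finite
  set, a `g`-symmetric `ℕ`-weight even at the `g`-fixed points ⟹ the total is even.
* **`even_sum_lambdaInvariant_mul`** (B0 + B1 assembled): for `p ≠ 2`, a finite `ι`-stable set `s` of points of
  `Spec Λ` none containing `T`, and ANY `ι`-symmetric `e : Spec Λ → ℕ`,
  `∑_{𝔭 ∈ s} λ(Λ/𝔭) · e(𝔭)` is EVEN.
* B2/B3 `forall_mul_eq_zero_of_even_of_add_le_one`, **`forall_eq_zero_of_budget_le_one`**,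
  `even_add_sum_lambdaInvariant_mul_iff`: if `e₀ + ∑_{𝔭 ∈ s} λ(Λ/𝔭)·e(𝔭) ≤ 1` then `e(𝔭) = 0` at every `𝔭 ∈ s`
  with `λ(Λ/𝔭) ≠ 0`, and in general the budget has the parity of its `(T)`-term `e₀`.

READING (the ledger of `Theorems/…KatoSporadicLedgerX8*.lean`, `…LedgerIota.lean`; not re-derived here): index the
height-one primes `𝔭 ∌ 3`, `𝔭 ≠ (T)` carrying K1-defect `e(𝔭) = k(𝔭) − x(𝔭) ≥ 0` (Kato 12.5 / Sprung 7.16 give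
`x ≤ k`) by a finite `ι`-stable set; the TOTAL defect `Δ = e_(T) + ∑ d·e = λ(𝐇¹/Z) − λ(𝐇²)` off `μ` is what a
congruence transport (Kim–Lee–Ponsinet 2019 Thm 2.1 (2), PRE) moves between members of `S₂(ρ̄)`. GIVEN the mirror
law `e(ι𝔭) = e(𝔭)` (the duality-ledger input Σ♮ — a DISPLAYED hypothesis `he` below, not proved here) this file
says `Δ ≡ e_(T) (mod 2)` and `Δ ≤ 1 ⟹` every sporadic / positive-level-cyclotomic defect vanishes — without the
mirror law a budget of one could still sit at ONE rational sporadic zero `(T − u)`, which B0's corollary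
`comap_invol_ne_of_asIdeal_eq_span_X_sub_C` shows is never `ι`-fixed. Nothing here supplies `Δ ≤ 1` or Σ♮; BSD,
K1 `SprungLowerDivisibilityAtThree`, K_spor are NOT proved by any of this. Pure commutative algebra / finite sums.
-/

-- the single-conjunct summit namespace `Summit.BirchSwinnertonDyer.BirchSwinnertonDyer` repeats by design (D-0017)
set_option linter.dupNamespace false
set_option autoImplicit false

noncomputable section

namespace Summit.BirchSwinnertonDyer.BirchSwinnertonDyer.Theorems.IotaFixedParity

open Literature.NumberTheory.EllipticCurves Literature.NumberTheory.EllipticCurves.IwasawaAlgebra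

/-! ## §1 Finite sums with an involution (B1, B2) -/

/-- **Pairing lemma (B1).** Let `g` be an involution of a finite set `s` (`g (g x) = x`, `g x ∈ s`) and `f : α → ℕ`
a `g`-symmetric weight (`f (g x) = f x`) which is EVEN at every fixed point of `g` in `s`. Then `∑_{x ∈ s} f x` is
even: read the sum in `ZMod 2`, where `g`-pairs and fixed points both contribute `0` (`Finset.sum_involution`). -/
theorem even_sum_of_invol_pairing {α : Type*} [DecidableEq α] (s : Finset α) (f : α → ℕ) (g : α → α)
    (hg_mem : ∀ x ∈ s, g x ∈ s) (hgg : ∀ x ∈ s, g (g x) = x) (hsymm : ∀ x ∈ s, f (g x) = f x)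
    (hfix : ∀ x ∈ s, g x = x → Even (f x)) : Even (∑ x ∈ s, f x) := by
  rw [← ZMod.natCast_eq_zero_iff_even, Nat.cast_sum]
  refine Finset.sum_involution (fun x _ ↦ g x) (fun x hx ↦ ?_) (fun x hx hne ↦ ?_) (fun x hx ↦ hg_mem x hx)
    (fun x hx ↦ hgg x hx)
  · rw [hsymm x hx, ← Nat.cast_add, ← two_mul, Nat.cast_mul, ZMod.natCast_self, zero_mul]
  · intro hfx
    exact hne ((ZMod.natCast_eq_zero_iff_even).mpr (hfix x hx hfx))

/-- **`∑ d·e` is even (B1, product form)** for `g`-symmetric `d, e` on a finite `g`-stable index set with `d` even at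
the `g`-fixed indices. -/
theorem even_sum_mul_of_invol_pairing {α : Type*} [DecidableEq α] (s : Finset α) (d e : α → ℕ) (g : α → α)
    (hg_mem : ∀ x ∈ s, g x ∈ s) (hgg : ∀ x ∈ s, g (g x) = x) (hd : ∀ x ∈ s, d (g x) = d x)
    (he : ∀ x ∈ s, e (g x) = e x) (hfix : ∀ x ∈ s, g x = x → Even (d x)) :
    Even (∑ x ∈ s, d x * e x) :=
  even_sum_of_invol_pairing s (fun x ↦ d x * e x) g hg_mem hgg (fun x hx ↦ by rw [hd x hx, he x hx])
    (fun x hx hgx ↦ (hfix x hx hgx).mul_right _)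

/-- **Budget-one shell (B2).** If `e₀ + S ≤ 1` with `S = ∑_{x ∈ s} d x * e x` even then `S = 0`, so every term
vanishes. -/
theorem forall_mul_eq_zero_of_even_of_add_le_one {α : Type*} (s : Finset α) (d e : α → ℕ) (e₀ : ℕ)
    (heven : Even (∑ x ∈ s, d x * e x)) (hle : e₀ + ∑ x ∈ s, d x * e x ≤ 1) :
    ∀ x ∈ s, d x * e x = 0 := by
  have h0 : ∑ x ∈ s, d x * e x = 0 := by
    obtain ⟨k, hk⟩ := heven
    omega
  exact fun x hx ↦ (Finset.sum_eq_zero_iff.mp h0) x hx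

/-- Parity of a budget with even sporadic part (B3, arithmetic shell): `Even (e₀ + S) ↔ Even e₀` for `S` even. -/
theorem even_add_iff_of_even {e₀ S : ℕ} (hS : Even S) : Even (e₀ + S) ↔ Even e₀ := by
  rw [Nat.even_add]
  exact ⟨fun h ↦ h.mpr hS, fun h ↦ ⟨fun _ ↦ hS, fun _ ↦ h⟩⟩

/-! ## §2 The door over `Spec Λ`: `λ`-weighted `ι`-symmetric sums are even (B0 + B1) -/

variable {p : ℕ} [Fact p.Prime]

/-- **The `ι`-parity door.** Let `p ≠ 2`, let `s` be a finite set of points of `Spec Λ` (`Λ = ℤ_p⟦T⟧`) stable under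
the Iwasawa involution `ι` and with `T ∉ 𝔭` for every `𝔭 ∈ s`, and let `e : Spec Λ → ℕ` be `ι`-symmetric on `s`.
Then `∑_{𝔭 ∈ s} λ(Λ/𝔭) · e(𝔭)` is EVEN: the `ι`-orbits `{𝔭, ι𝔭}` with `𝔭 ≠ ι𝔭` contribute twice the same term
(`λ(Λ/ι𝔭) = λ(Λ/𝔭)`, `lambdaInvariant_quotient_comap_invol_asIdeal_eq`), and at an `ι`-fixed `𝔭 ∌ T` the degree
`λ(Λ/𝔭)` is itself even (B0, `even_lambdaInvariant_quotient_of_comap_invol_eq`). Typical `s`: the height-one primes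
`∌ p`, `≠ (T)` in the support of a torsion `Λ`-module, `e` a defect; the mirror law `he` is the INPUT (Σ♮). -/
theorem even_sum_lambdaInvariant_mul (hp2 : p ≠ 2) (s : Finset (PrimeSpectrum (IwasawaAlgebra p)))
    (hs : ∀ 𝔭 ∈ s, PrimeSpectrum.comap (invol p).toRingHom 𝔭 ∈ s)
    (hT : ∀ 𝔭 ∈ s, (PowerSeries.X : IwasawaAlgebra p) ∉ 𝔭.asIdeal)
    (e : PrimeSpectrum (IwasawaAlgebra p) → ℕ)
    (he : ∀ 𝔭 ∈ s, e (PrimeSpectrum.comap (invol p).toRingHom 𝔭) = e 𝔭) :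
    Even (∑ 𝔭 ∈ s, lambdaInvariant p (IwasawaAlgebra p ⧸ 𝔭.asIdeal) * e 𝔭) := by
  classical
  exact even_sum_mul_of_invol_pairing s (fun 𝔭 ↦ lambdaInvariant p (IwasawaAlgebra p ⧸ 𝔭.asIdeal)) e
    (PrimeSpectrum.comap (invol p).toRingHom) hs (fun 𝔭 _ ↦ Kato2004.comap_invol_comap_invol 𝔭)
    (fun 𝔭 _ ↦ lambdaInvariant_quotient_comap_invol_asIdeal_eq 𝔭) he
    (fun 𝔭 h𝔭 hfix ↦ even_lambdaInvariant_quotient_of_comap_invol_eq hp2 𝔭 hfix (hT 𝔭 h𝔭))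

/-- **The budget has the parity of its `(T)`-term (B3)**: with `s`, `e` as in `even_sum_lambdaInvariant_mul`,
`Even (e₀ + ∑_{𝔭 ∈ s} λ(Λ/𝔭)·e(𝔭)) ↔ Even e₀`. In the ledger: the total defect `Δ = λ(𝐇¹/Z) − λ(𝐇²)` (off `μ`)
is congruent mod `2` to the defect at `(T)`, granted the mirror law. -/
theorem even_add_sum_lambdaInvariant_mul_iff (hp2 : p ≠ 2) (s : Finset (PrimeSpectrum (IwasawaAlgebra p)))
    (hs : ∀ 𝔭 ∈ s, PrimeSpectrum.comap (invol p).toRingHom 𝔭 ∈ s)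
    (hT : ∀ 𝔭 ∈ s, (PowerSeries.X : IwasawaAlgebra p) ∉ 𝔭.asIdeal)
    (e : PrimeSpectrum (IwasawaAlgebra p) → ℕ)
    (he : ∀ 𝔭 ∈ s, e (PrimeSpectrum.comap (invol p).toRingHom 𝔭) = e 𝔭) (e₀ : ℕ) :
    Even (e₀ + ∑ 𝔭 ∈ s, lambdaInvariant p (IwasawaAlgebra p ⧸ 𝔭.asIdeal) * e 𝔭) ↔ Even e₀ :=
  even_add_iff_of_even (even_sum_lambdaInvariant_mul hp2 s hs hT e he)

/-- **Budget-one door.** With `s`, `e` as in `even_sum_lambdaInvariant_mul`: if the total budget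
`e₀ + ∑_{𝔭 ∈ s} λ(Λ/𝔭)·e(𝔭)` is `≤ 1` then `e(𝔭) = 0` at every `𝔭 ∈ s` of non-zero degree `λ(Λ/𝔭) ≠ 0`
(every height-one `𝔭 ∌ p` has `λ(Λ/𝔭) = deg ≥ 1`) — the unit of budget, if any, sits at `(T)`. In the ledger:
`Δ ≤ 1` and the mirror law force every sporadic and every positive-level cyclotomic K1-defect to vanish
(card k2-g4 Plan 3: «Σ♮ ∧ Δ ≤ 1 ⟹ K_spor»); the supplier of `Δ ≤ 1` (a congruence transport) is NOT here. -/
theorem forall_eq_zero_of_budget_le_one (hp2 : p ≠ 2) (s : Finset (PrimeSpectrum (IwasawaAlgebra p)))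
    (hs : ∀ 𝔭 ∈ s, PrimeSpectrum.comap (invol p).toRingHom 𝔭 ∈ s)
    (hT : ∀ 𝔭 ∈ s, (PowerSeries.X : IwasawaAlgebra p) ∉ 𝔭.asIdeal)
    (e : PrimeSpectrum (IwasawaAlgebra p) → ℕ)
    (he : ∀ 𝔭 ∈ s, e (PrimeSpectrum.comap (invol p).toRingHom 𝔭) = e 𝔭) (e₀ : ℕ)
    (hle : e₀ + ∑ 𝔭 ∈ s, lambdaInvariant p (IwasawaAlgebra p ⧸ 𝔭.asIdeal) * e 𝔭 ≤ 1) :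
    ∀ 𝔭 ∈ s, lambdaInvariant p (IwasawaAlgebra p ⧸ 𝔭.asIdeal) ≠ 0 → e 𝔭 = 0 := fun 𝔭 h𝔭 hd ↦
  (mul_eq_zero.mp (forall_mul_eq_zero_of_even_of_add_le_one s _ e e₀
    (even_sum_lambdaInvariant_mul hp2 s hs hT e he) hle 𝔭 h𝔭)).resolve_left hd

/-- **Without the mirror law**: a budget `≤ 1` leaves at most ONE index with a non-zero term, and that index has
`λ(Λ/𝔭)·e(𝔭) = 1`, so degree `λ(Λ/𝔭) = 1` — a `ℤ_p`-RATIONAL prime. If moreover `e₀ = 0`… (pure counting; recorded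
for the ledger's «one rational sporadic defect» scenario, which `comap_invol_ne_of_asIdeal_eq_span_X_sub_C` then
places OFF the `ι`-fixed locus). -/
theorem lambdaInvariant_eq_one_of_budget_le_one_of_ne_zero (s : Finset (PrimeSpectrum (IwasawaAlgebra p)))
    (e : PrimeSpectrum (IwasawaAlgebra p) → ℕ) (e₀ : ℕ)
    (hle : e₀ + ∑ 𝔭 ∈ s, lambdaInvariant p (IwasawaAlgebra p ⧸ 𝔭.asIdeal) * e 𝔭 ≤ 1)
    (𝔭 : PrimeSpectrum (IwasawaAlgebra p)) (h𝔭 : 𝔭 ∈ s)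
    (hne : lambdaInvariant p (IwasawaAlgebra p ⧸ 𝔭.asIdeal) * e 𝔭 ≠ 0) :
    lambdaInvariant p (IwasawaAlgebra p ⧸ 𝔭.asIdeal) = 1 ∧ e 𝔭 = 1 ∧ e₀ = 0 := by
  have hle' : lambdaInvariant p (IwasawaAlgebra p ⧸ 𝔭.asIdeal) * e 𝔭 ≤
      ∑ 𝔮 ∈ s, lambdaInvariant p (IwasawaAlgebra p ⧸ 𝔮.asIdeal) * e 𝔮 :=
    Finset.single_le_sum (f := fun 𝔮 ↦ lambdaInvariant p (IwasawaAlgebra p ⧸ 𝔮.asIdeal) * e 𝔮)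
      (fun _ _ ↦ Nat.zero_le _) h𝔭
  have h1 : lambdaInvariant p (IwasawaAlgebra p ⧸ 𝔭.asIdeal) * e 𝔭 = 1 := by omega
  exact ⟨Nat.eq_one_of_mul_eq_one_right h1, Nat.eq_one_of_mul_eq_one_left h1, by omega⟩

end Summit.BirchSwinnertonDyer.BirchSwinnertonDyer.Theorems.IotaFixedParity

end
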